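import Literature.Analysis.Convexity.ComplexTransport
import HarnessLib

/-!
# Unions of simplicial complexes and subfamilies determined by their underlying space

Two elementary facts about geometric simplicial complexes used in the extension step of the
triangulation programme:

* `Literature.Analysis.Convexity.unionComplex` — the union of the face families of two complexes
  is a complex as soon as simplices of the two complexes meet in common faces;
* `Literature.Analysis.Convexity.mem_of_convexHull_subset_biUnion` — a simplex of a complex whose
  closed simplex is covered by the closed simplices of a down-closed subfamily belongs to that
  subfamily (its barycentre lies in some simplex of the subfamily, which then contains it).

No named facts are introduced. [folklore]
-/

open Set

noncomputable section

namespace Literature.Analysis.Convexity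

section Union

variable {E : Type*} [AddCommGroup E] [Module ℝ E] [DecidableEq E]

/-- **Union of two complexes.** If every simplex of `K₁` meets every simplex of `K₂` in a common
face, the union of the two face families is a geometric simplicial complex. [folklore] -/
def unionComplex (K₁ K₂ : Geometry.SimplicialComplex ℝ E)
    (h : ∀ s ∈ K₁.faces, ∀ t ∈ K₂.faces,
      convexHull ℝ (s : Set E) ∩ convexHull ℝ (t : Set E) ⊆ convexHull ℝ (↑(s ∩ t) : Set E)) :
    Geometry.SimplicialComplex ℝ E where
  faces := K₁.faces ∪ K₂.faces
  indep := by
    rintro s (hs | hs)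
    · exact K₁.indep hs
    · exact K₂.indep hs
  isRelLowerSet_faces := by
    rintro s (hs | hs)
    · exact ⟨K₁.nonempty_of_mem_faces hs, fun t hts htn => Or.inl (K₁.down_closed hs hts htn)⟩
    · exact ⟨K₂.nonempty_of_mem_faces hs, fun t hts htn => Or.inr (K₂.down_closed hs hts htn)⟩
  inter_subset_convexHull := by
    rintro s t (hs | hs) (ht | ht)
    · exact K₁.inter_subset_convexHull hs ht
    · rw [← Finset.coe_inter]; exact h s hs t ht
    · intro x hx
      have := h t ht s hs ⟨hx.2, hx.1⟩
      rw [Finset.inter_comm] at this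
      rw [← Finset.coe_inter]; exact this
    · exact K₂.inter_subset_convexHull hs ht

/-- The faces of the union complex. [folklore] -/
theorem unionComplex_faces (K₁ K₂ : Geometry.SimplicialComplex ℝ E)
    (h : ∀ s ∈ K₁.faces, ∀ t ∈ K₂.faces,
      convexHull ℝ (s : Set E) ∩ convexHull ℝ (t : Set E) ⊆ convexHull ℝ (↑(s ∩ t) : Set E)) :
    (unionComplex K₁ K₂ h).faces = K₁.faces ∪ K₂.faces := rfl

/-- The underlying space of the union complex. [folklore] -/
theorem unionComplex_space (K₁ K₂ : Geometry.SimplicialComplex ℝ E)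
    (h : ∀ s ∈ K₁.faces, ∀ t ∈ K₂.faces,
      convexHull ℝ (s : Set E) ∩ convexHull ℝ (t : Set E) ⊆ convexHull ℝ (↑(s ∩ t) : Set E)) :
    (unionComplex K₁ K₂ h).space = K₁.space ∪ K₂.space := by
  ext x
  simp only [Geometry.SimplicialComplex.mem_space_iff, unionComplex_faces, mem_union]
  constructor
  · rintro ⟨s, hs | hs, hxs⟩
    · exact Or.inl ⟨s, hs, hxs⟩
    · exact Or.inr ⟨s, hs, hxs⟩
  · rintro (⟨s, hs, hxs⟩ | ⟨s, hs, hxs⟩)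
    · exact ⟨s, Or.inl hs, hxs⟩
    · exact ⟨s, Or.inr hs, hxs⟩

end Union

section Covered

variable {E : Type*} [NormedAddCommGroup E] [NormedSpace ℝ E]

/-- **A simplex covered by a down-closed subfamily belongs to it.** If the closed simplex of a
simplex `r` of `K` is covered by the closed simplices of a down-closed subfamily `A` of `K`, then
`r ∈ A`: the barycentre of `r` lies in some simplex `ρ ∈ A`, hence `r ⊆ ρ`. [folklore] -/
theorem mem_of_convexHull_subset_biUnion {K : Geometry.SimplicialComplex ℝ E} {A : Set (Finset E)}
    (hA : A ⊆ K.faces) (hdown : ∀ ρ ∈ A, ∀ r ⊆ ρ, r.Nonempty → r ∈ A) {r : Finset E}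
    (hr : r ∈ K.faces) (hcov : convexHull ℝ (r : Set E) ⊆ ⋃ ρ ∈ A, convexHull ℝ (ρ : Set E)) :
    r ∈ A := by
  classical
  have hne : r.Nonempty := K.nonempty_of_mem_faces hr
  obtain ⟨ρ, hρ, hb⟩ := mem_iUnion₂.1 (hcov (bary_mem_convexHull hne))
  exact hdown ρ hρ r (subset_of_bary_mem_convexHull hr (hA hρ) hb) hne

/-- **Subfamilies with the same underlying space coincide** (one inclusion): if every closed
simplex of the down-closed subfamily `B ⊆ K.faces` is covered by the closed simplices of the
down-closed subfamily `A`, then `B ⊆ A`. [folklore] -/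
theorem subset_of_forall_convexHull_subset_biUnion {K : Geometry.SimplicialComplex ℝ E}
    {A B : Set (Finset E)} (hA : A ⊆ K.faces) (hdown : ∀ ρ ∈ A, ∀ r ⊆ ρ, r.Nonempty → r ∈ A)
    (hB : B ⊆ K.faces)
    (hcov : ∀ r ∈ B, convexHull ℝ (r : Set E) ⊆ ⋃ ρ ∈ A, convexHull ℝ (ρ : Set E)) : B ⊆ A :=
  fun r hr => mem_of_convexHull_subset_biUnion hA hdown (hB hr) (hcov r hr)

end Covered

end Literature.Analysis.Convexity
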